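import Summits.Parity.GeneralizedHardyLittlewood.Theorems.LeeYangFibresRelativeDimOneDefs
import Mathlib.NumberTheory.DirichletCharacter.Basic
import HarnessLib

/-!
# Route `LeeYangFibres`, crux `RelativeDimOne` (stmt-Parity-14113): vocabulary of the NECESSITY certificates
(card `gallagher-backwards-split`) for the line `SketchIdeator1` = `translate-amplification`

Route-posited statements (D-0016 `<Route><Crux>…Defs` file), NOTHING ASSERTED. The line
`translate-amplification` has shown (kernel-checked, `Theorems/LeeYangFibresRelativeDimOneEquivalence.lean`)
that the crux `RelativeDimOne` is EQUIVALENT to its atom `CoarseHLSlack` (two-sided order-of-magnitude bounds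
for prime constellations with sub-exponential loss in the number of forms). The idea card
`Cruxes/RelativeDimOne/Ideas/gallagher-backwards-split.md` reads Gallagher's identity
`∑_{a mod q} ψ(N;q,a)² = ∑_{n ≤ N} Λ(n)² + 2 ∑_{k ≥ 1} S_N(qk)`, `S_N(h) = ∑_{n ≤ N−h} Λ(n)Λ(n+h)`, BACKWARDS:
upper bounds for the pair sums `S_N(qk)` (instances of the crux at `t = 2`, shifts `qk ≤ N`, `K = [1, N−qk]`)
pin a SHARP SECOND MOMENT of primes in residue classes for every modulus `q ≤ N`
(`SharpClassSecondMoment`), which by orthogonality of characters forces the prime number theorem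
`ψ(N, χ) = o(N)` for EVERY non-principal character of conductor `≤ N^θ`, every `θ < 1` (`UniformCharPNT`,
a consequence of GRH that is open unconditionally — Siegel zeros, zeros near `1`, and the range `q > N^{1/2}`).
Only UPPER bounds on `S_N(qk)` are used, so the certificates apply to the UPPER HALF of the crux
(`UpperRelativeDimOne`) and, through upper-half amplification, to the upper half of the atom
(`CoarseUpperHLSlack`): sub-exponential dimension dependence of prime-constellation UPPER bounds is already
`UniformCharPNT`-hard. This file types the four statements and `classPsi`/`charPsi`; the certificates
`upperRelativeDimOne_of_coarseUpperHLSlack`, `latticeNecessity : UpperRelativeDimOne → SharpClassSecondMoment`,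
`characterNecessity : SharpClassSecondMoment → UniformCharPNT` are registered sub-goals of stmt-Parity-14113
landed in their own files.

References: Gallagher, Mathematika 23 (1976) [Gallagher1976]; Friedlander–Goldston, Quart. J. Math. 47 (1996)
Prop. 1 [FriedlanderGoldston1996]; Goldston–Suriajaya (2021) §7 [GoldstonSuriajaya2021]; Green–Tao (2010)
Conj. 1.4 [GreenTao2010].
-/

noncomputable section

open scoped BigOperators Classical Topology ArithmeticFunction.vonMangoldt
open Finset Filter Literature.NumberTheory.Sieve
open Summit.Parity.GeneralizedHardyLittlewood.Theses.LeeYangFibres (RelativeDimOne)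

namespace Summit.Parity.GeneralizedHardyLittlewood.Cruxes.RelativeDimOne.GallagherBackwards

/-! ### Objects -/

/-- `ψ(N; q, a) = ∑_{1 ≤ n ≤ N, n % q = a} Λ(n)` (all residues `a < q`, coprime or not). -/
def classPsi (N q a : ℕ) : ℝ :=
  ∑ n ∈ (Finset.Icc 1 N).filter (fun n => n % q = a), Λ n

/-- `ψ(N, χ) = ∑_{1 ≤ n ≤ N} Λ(n) χ(n)` for a Dirichlet character `χ mod q`. -/
def charPsi {q : ℕ} (χ : DirichletCharacter ℂ q) (N : ℕ) : ℂ :=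
  ∑ n ∈ Finset.Icc 1 N, (Λ n : ℂ) * χ (n : ZMod q)

/-- `ψ(N; q, a) ≥ 0` (registered sub-goal under which this vocabulary file lands). -/
theorem classPsi_nonneg : ∀ N q a : ℕ, 0 ≤ classPsi N q a :=
  fun _ _ _ => Finset.sum_nonneg fun _ _ => ArithmeticFunction.vonMangoldt_nonneg

/-! ### Statements (types of the registered certificates; nothing is asserted) -/

/-- SHARP CLASS SECOND MOMENT (individual-modulus Barban–Davenport–Halberstam / `ℓ²`-Brun–Titchmarsh with
constant `1`): for every modulus `1 ≤ q ≤ N`, `∑_{a mod q} ψ(N;q,a)² ≤ (1+ε)(N²/φ(q) + N log N)` for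
`N ≥ N₀(ε)`. A consequence of GRH; open unconditionally. -/
def SharpClassSecondMoment : Prop :=
  ∀ ε : ℝ, 0 < ε → ∃ N₀ : ℕ, ∀ N : ℕ, N₀ ≤ N → ∀ q : ℕ, 1 ≤ q → q ≤ N →
    ∑ a ∈ Finset.range q, classPsi N q a ^ 2 ≤
      (1 + ε) * ((N : ℝ) ^ 2 / Nat.totient q + N * Real.log N)

/-- UNIFORM CHARACTER PNT up to conductor `N^θ`, every `θ < 1`: `|ψ(N,χ)| ≤ ε N` for every non-principal
`χ mod q`, `2 ≤ q ≤ N^θ`, `N ≥ N₀(θ, ε)`. Implied by GRH; open (Siegel zeros; zeros at `1 − C/log q`;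
no `L`-function tool at all for `q > N^{1/2}`). -/
def UniformCharPNT : Prop :=
  ∀ θ : ℝ, θ < 1 → ∀ ε : ℝ, 0 < ε → ∃ N₀ : ℕ, ∀ N : ℕ, N₀ ≤ N →
    ∀ q : ℕ, 2 ≤ q → (q : ℝ) ≤ (N : ℝ) ^ θ →
      ∀ χ : DirichletCharacter ℂ q, χ ≠ 1 → ‖charPsi χ N‖ ≤ ε * N

/-- The UPPER HALF of the crux `RelativeDimOne`: `S(Ψ,K) ≤ (1+ε) β_∞𝔖 + εN` uniformly. -/
def UpperRelativeDimOne : Prop :=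
  ∀ (t L : ℕ), 1 ≤ t → ∀ ε : ℝ, 0 < ε → ∃ N₀ : ℕ, ∀ N : ℕ, N₀ ≤ N →
    ∀ Ψ : Fin t → AffLinForm 1, IsNondegenerateSystem Ψ → affLinSize Ψ N ≤ L →
      ∀ K : Set (Fin 1 → ℝ), Convex ℝ K → K ⊆ realBox 1 N →
        vonMangoldtSum Ψ K N ≤ (1 + ε) * (archFactor Ψ K * singularProduct Ψ) + ε * N

/-- The UPPER HALF of the line's atom `CoarseHLSlack`: coarse upper bounds `S ≤ e^{g(T)} β_∞𝔖 + ηN` for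
prime constellations with sub-exponential loss `g(T) = o(T)` in the number of forms and `o(N)` slack,
uniformly over non-degenerate `T`-systems of size `≤ L`. -/
def CoarseUpperHLSlack : Prop :=
  ∃ g : ℕ → ℝ, Tendsto (fun T : ℕ => g T / T) atTop (𝓝 0) ∧
    ∀ (T L : ℕ), 1 ≤ T → ∀ η : ℝ, 0 < η → ∃ N₀ : ℕ, ∀ N : ℕ, N₀ ≤ N →
      ∀ Φ : Fin T → AffLinForm 1, IsNondegenerateSystem Φ → affLinSize Φ N ≤ L →
        ∀ K : Set (Fin 1 → ℝ), Convex ℝ K → K ⊆ realBox 1 N →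
          vonMangoldtSum Φ K N ≤ Real.exp (g T) * (archFactor Φ K * singularProduct Φ) + η * N

/-- The crux contains its upper half. -/
theorem upperRelativeDimOne_of_relativeDimOne : RelativeDimOne → UpperRelativeDimOne := by
  intro h t L ht ε hε
  obtain ⟨N₀, hN₀⟩ := h t L ht ε hε
  refine ⟨N₀, fun N hN Ψ hΨ hL K hK hKN => ?_⟩
  have hb := (abs_le.mp (hN₀ N hN Ψ hΨ hL K hK hKN)).2
  linarith

/-- The atom contains its upper half. -/
theorem coarseUpperHLSlack_of_coarseHLSlack :
    TranslateAmplification.CoarseHLSlack → CoarseUpperHLSlack := by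
  rintro ⟨g, hg, h⟩
  refine ⟨g, hg, fun T L hT η hη => ?_⟩
  obtain ⟨N₀, hN₀⟩ := h T L hT η hη
  exact ⟨N₀, fun N hN Φ hΦ hL K hK hKN => (hN₀ N hN Φ hΦ hL K hK hKN).1⟩

end Summit.Parity.GeneralizedHardyLittlewood.Cruxes.RelativeDimOne.GallagherBackwards
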